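import Literature.NumberTheory.Weil1964.ArchMetaplecticDoublingSection
import Literature.NumberTheory.Weil1964.ArchMetaplecticDoubleCoverHolds
import HarnessLib

/-!
# Where the metaplectic double cover splits — UNCONDITIONAL forms: over `GL⁺(n, ℝ)` and over the doubling diagonal
# (but NOT over the full Siegel Levi `GL(n, ℝ)`); `Mp₂(W)` is normal in `Mp^𝓢(W)`

Topic `NumberTheory/Weil1964`; namespace `Literature.NumberTheory.Weil1964.MpS`.  The theorems of
`Literature.NumberTheory.Weil1964.ArchMetaplecticNormality`, `…ArchMetaplecticLeviCover` and
`…ArchMetaplecticDoublingSection` (pub-hodgecm2 literature fan-out, row B08-2 (b), the reduction layer of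
[Paul1998, (1.2.1)] for Folland's `Mp₂(W)`) were stated over the two records R1 `Folland1989_Thm_4_37_ab σ` and
R2 `Folland1989_Thm_4_37_c σ` of `ArchMetaplecticDoubleCover` as explicit hypotheses.  Both records are now THEOREMS
(`folland1989_Thm_4_37_ab_holds`, `folland1989_Thm_4_37_c_holds` of
`Literature.NumberTheory.Weil1964.ArchMetaplecticDoubleCoverHolds`, row B07-3), so this file records the hypothesis-free
statements (one-line instantiations under new names; 0 `def`, 0 named facts, net debt 0) and the packaging that only
makes sense unconditionally — homomorphic sections of the covering projection `pr : Mp₂(W) → Sp(W)` ITSELF: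

* §1 for EVERY implementer `y ∈ Mp^𝓢(W)`: `‖C(y)‖² ‖det P(proj y)‖ = 1` (`norm_vac_sq_mul_norm_det_eq_one`, Folland's
  `|⟨ν(𝒜)E₀,E₀⟩| = |det P|^{-1/2}` for every phase), `C(y) ≠ 0` (`vac_ne_zero`); Folland's normalisation is stable under
  conjugation by all of `Mp^𝓢(W)` (`IsMetaplectic.conj`), i.e. **`Mp₂(W) ⊴ Mp^𝓢(W)`** (`Mp₂.normal`);
* §2 the Siegel Levi: `levi a d` is metaplectic **iff `det a > 0`** (`isMetaplectic_levi_iff_det_pos`), the fibre over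
  `m(a, d)` is `± levi a d` for `det a > 0` and `± i · levi a d` for `det a < 0`
  (`isMetaplectic_unitScalar_mul_levi_iff_sign`); **the double cover `pr : Mp₂(W) → Sp(W)` SPLITS over the positive
  Levi `GL⁺(n, ℝ)`** by the geometric section `(a, ᵗa⁻¹) ↦ (f ↦ |det a|^{-1/2} f ∘ a⁻¹)`
  (`leviHomPos_isMetaplectic`, `Mp₂.exists_section_leviPairsPos`, fibres `Mp₂.eq_or_eq_negOne_mul_of_pr_eq_leviSp`),
  and — NEW — **it does NOT split over the full Siegel Levi `GL(n, ℝ)`** (`Mp₂.not_exists_section_leviPairs`,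
  `σ ≠ ∅`): a lift of `m(r, r)`, `r` a coordinate reflection, is `± i · levi r r` and squares to `ε = −1`, although the
  `S¹`-extension `Mp^𝓢(W) → Sp(W)` does split there (`leviHom` of `ArchMetaplecticLeviCover`) — the real-place statement
  that the inverse image of the Siegel Levi is the non-trivial `det^{1/2}`-cover of `GL(n, ℝ)` [Adams2007, §3, §5
  Rem. 5.6; Kudla1994, §3];
* §3 the doubling / twisted diagonal `T ↦ T ⊕ cTc` of `Sp(W)` in `Sp(W ⊕ W)`: the doubling section has metaplectic
  values (`doublingSection_isMetaplectic`), **`pr : Mp₂(W ⊕ W) → Sp(W ⊕ W)` SPLITS over the twisted diagonal**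
  (`Mp₂.exists_section_twistedDiagonal`), with fibres `± doublingSection y T`
  (`IsMetaplectic.eq_or_eq_negOne_mul_doublingSection`) [GelbartPiatetskishapiroRallis1987, Part A §1; Kudla1994, §§1–3].

Everything here is PROVED (kernel); citations record provenance only.

## References

* [Folland1989] G. B. Folland, *Harmonic Analysis in Phase Space*, Annals of Mathematics Studies 122, Princeton UP 1989
  (held text `book:folland1989-harmonic-analysis-phase-space`): §4.2 (4.23), (4.24), (4.36), Thm. (4.37) p0160, proof
  p0161, Prop. (4.39).
* [Adams2007] J. Adams, *The theta correspondence over ℝ*, in: Harmonic Analysis, Group Representations, Automorphic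
  Forms and Invariant Theory, World Scientific (2007) 1–39 (held text
  `book:li2007-harmonic-analysis-group-representations-automorphic-forms-invariant`): §3 chunk p0011 L7 («`K̃` … is
  isomorphic to the `det^{1/2}` cover»), §5 Rem. 5.6 chunk p0018 L17–21 and p0019 L1 («even if (4.6) is not split … the
  `det^{1/2}` cover of GL(n)»).
* [Kudla1994] S. Kudla, *Splitting metaplectic covers of dual reductive pairs*, Israel J. Math. 87 (1994) 361–401, §§1–3.
* [GelbartPiatetskishapiroRallis1987] S. Gelbart, I. Piatetski-Shapiro, S. Rallis, *Explicit constructions of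
  automorphic L-functions*, LNM 1254 (1987), Part A §1.
* [Paul1998] A. Paul, *Howe correspondence for real unitary groups*, J. Funct. Anal. 159 (1998) 384–431, §1.2 (1.2.1).
-/

set_option autoImplicit false

noncomputable section

open Matrix

namespace Literature.NumberTheory.Weil1964

open Literature.Analysis.SegalBargmann Literature.RepresentationTheory.HeisenbergGroup

variable {σ : Type*} [Fintype σ] [DecidableEq σ]

namespace MpS

/-! ## 1. Every implementer: `‖C(y)‖² ‖det P‖ = 1`, `C(y) ≠ 0`; `Mp₂(W)` is normal in `Mp^𝓢(W)` -/

/-- **`‖C(y)‖² · ‖det P(proj y)‖ = 1` for EVERY `y ∈ Mp^𝓢(W)`** — Folland's `|⟨ν(𝒜)E₀, E₀⟩| = |det^{-1/2} P|`, valid for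
every choice of the phase; R1 discharged by `folland1989_Thm_4_37_ab_holds`. [cite: Folland1989, §4.2 (4.36), Thm. (4.37)] -/
theorem norm_vac_sq_mul_norm_det_eq_one (y : MpS σ) : ‖vac y‖ ^ 2 * ‖(Sp.follandP (proj y)).det‖ = 1 :=
  norm_vac_sq_mul_norm_det (folland1989_Thm_4_37_ab_holds σ) y

/-- **Every implementer has a non-zero vacuum coefficient** `C(y) = ⟪k₀, y k₀⟫ ≠ 0`. [cite: Folland1989, §4.2 (4.36), Thm. (4.37)] -/
theorem vac_ne_zero (y : MpS σ) : vac y ≠ 0 :=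
  vac_ne_zero_of_thm_4_37_ab (folland1989_Thm_4_37_ab_holds σ) y

/-- **Folland's normalisation is stable under conjugation by ALL of `Mp^𝓢(W)`**: `y x y⁻¹` is metaplectic whenever `x`
is, for every implementer `y`. [cite: Folland1989, §4.2 Thm. (4.37)] -/
theorem IsMetaplectic.conj {x : MpS σ} (hx : IsMetaplectic x) (y : MpS σ) : IsMetaplectic (y * x * y⁻¹) :=
  hx.conj_of (folland1989_Thm_4_37_ab_holds σ) (folland1989_Thm_4_37_c_holds σ) y

/-- **`Mp₂(W)` is a NORMAL subgroup of `Mp^𝓢(W)`** (so a metaplectic section over `H ≤ Sp(W)` conjugates, by any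
implementer of `h`, to one over `h H h⁻¹`). [cite: Folland1989, §4.2 Thm. (4.37); Adams2007, §3] -/
theorem Mp₂.normal : (Mp₂ σ).Normal :=
  ⟨fun _ hx y => Mp₂.mem_of_isMetaplectic
    (((Mp₂.mem_iff (folland1989_Thm_4_37_ab_holds σ) (folland1989_Thm_4_37_c_holds σ)).1 hx).conj y)⟩

/-! ## 2. The Siegel Levi: the double cover splits over `GL⁺(n, ℝ)` and does not split over `GL(n, ℝ)` -/

/-- **`levi a d` is metaplectic iff `det a > 0`**: Folland's normalisation holds ON THE NOSE for the geometric Levi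
operators `f ↦ |det a|^{-1/2} f(a⁻¹x)` exactly when `det a > 0`. [cite: Folland1989, §4.2 (4.24), Thm. (4.37)] -/
theorem isMetaplectic_levi_iff_det_pos (a d : (σ → ℝ) ≃ₗ[ℝ] (σ → ℝ))
    (had : ∀ x y, dotPairing σ (a x) (d y) = dotPairing σ x y) :
    IsMetaplectic (levi a d had) ↔ 0 < LinearMap.det (a : (σ → ℝ) →ₗ[ℝ] (σ → ℝ)) :=
  isMetaplectic_levi_iff (folland1989_Thm_4_37_ab_holds σ) a d had

/-- **The fibre of the double cover over the Siegel Levi**: `c · levi a d` (`|c| = 1`) is metaplectic iff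
`c² · sign(det a) = 1` — the lifts of `m(a, d)` are `± levi a d` when `det a > 0` and `± i · levi a d` when `det a < 0`.
[cite: Folland1989, §4.2 (4.24), Thm. (4.37); Adams2007, §3] -/
theorem isMetaplectic_unitScalar_mul_levi_iff_sign (c : ℂ) (hc : ‖c‖ = 1) (a d : (σ → ℝ) ≃ₗ[ℝ] (σ → ℝ))
    (had : ∀ x y, dotPairing σ (a x) (d y) = dotPairing σ x y) :
    IsMetaplectic (unitScalar c hc * levi a d had) ↔
      c ^ 2 * ((SignType.sign (LinearMap.det (a : (σ → ℝ) →ₗ[ℝ] (σ → ℝ))) : ℝ) : ℂ) = 1 :=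
  isMetaplectic_unitScalar_mul_levi_iff (folland1989_Thm_4_37_ab_holds σ) c hc a d had

/-- `leviHom m` is metaplectic iff `det a > 0` (`m = (a, ᵗa⁻¹)`). [cite: Folland1989, §4.2 (4.24), Thm. (4.37)] -/
theorem isMetaplectic_leviHom_iff_det_pos (m : leviPairs σ) :
    IsMetaplectic (leviHom σ m) ↔ 0 < LinearMap.det (m.1.1 : (σ → ℝ) →ₗ[ℝ] (σ → ℝ)) :=
  isMetaplectic_leviHom_iff (folland1989_Thm_4_37_ab_holds σ) m

/-- **The geometric section over the positive Levi `GL⁺(n, ℝ)` takes metaplectic values** — the Levi part of Folland's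
normalised cocycle is trivial on the identity component. [cite: Folland1989, §4.2 (4.24), Thm. (4.37); Kudla1994, §3] -/
theorem leviHomPos_isMetaplectic (m : leviPairsPos σ) : IsMetaplectic (leviHomPos σ m) :=
  isMetaplectic_leviHomPos (folland1989_Thm_4_37_ab_holds σ) m

/-- **THE DOUBLE COVER `pr : Mp₂(W) → Sp(W)` SPLITS OVER `GL⁺(n, ℝ)`**: there is a homomorphism
`s : GL⁺ →* Mp₂(W)` which IS the geometric section (`s m = levi a ᵗa⁻¹` as an element of `Mp^𝓢(W)`), hence lies over
`m(a, ᵗa⁻¹)`. [cite: Folland1989, §4.2 (4.24), Thm. (4.37); Kudla1994, §3; Adams2007, §5 Rem. 5.6] -/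
theorem Mp₂.exists_section_leviPairsPos :
    ∃ s : leviPairsPos σ →* Mp₂ σ, ∀ m, (s m : MpS σ) = leviHomPos σ m ∧
      Mp₂.pr (s m) = leviSp (dotPairing σ) m.1.1 m.1.2 m.2.1 :=
  ⟨(leviHomPos σ).codRestrict (Mp₂ σ) fun m => Mp₂.mem_of_isMetaplectic (leviHomPos_isMetaplectic m),
    fun _ => ⟨rfl, rfl⟩⟩

/-- **The two lifts over a point of `GL⁺(n, ℝ)`**: an element of `Mp₂(W)` over `m(a, ᵗa⁻¹)` with `det a > 0` is
`± levi a ᵗa⁻¹`. [cite: Folland1989, §4.2 Thm. (4.37), p. 161 L12–14] -/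
theorem Mp₂.eq_or_eq_negOne_mul_of_pr_eq_leviSp (m : leviPairsPos σ) (x : Mp₂ σ)
    (hx : Mp₂.pr x = leviSp (dotPairing σ) m.1.1 m.1.2 m.2.1) :
    (x : MpS σ) = leviHomPos σ m ∨ (x : MpS σ) = negOne * leviHomPos σ m :=
  (leviHomPos_isMetaplectic m).eq_or_eq_negOne_mul
    (Mp₂.isMetaplectic_coe (folland1989_Thm_4_37_ab_holds σ) (folland1989_Thm_4_37_c_holds σ) x)
    (by rw [proj_leviHomPos, ← Mp₂.pr_apply, hx])

/-- A coordinate reflection of `ℝ^σ` (`σ ≠ ∅`): an involution preserving the dot product, of determinant `−1`. [folklore] -/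
private theorem exists_reflection [Nonempty σ] :
    ∃ r : (σ → ℝ) ≃ₗ[ℝ] (σ → ℝ), (∀ x y, dotPairing σ (r x) (r y) = dotPairing σ x y) ∧ r * r = 1 ∧
      LinearMap.det (r : (σ → ℝ) →ₗ[ℝ] (σ → ℝ)) = -1 := by
  obtain ⟨i₀⟩ := ‹Nonempty σ›
  have hv : ∀ i, Function.update (1 : σ → ℝ) i₀ (-1) i * Function.update (1 : σ → ℝ) i₀ (-1) i = 1 := by
    intro i
    by_cases h : i = i₀
    · subst h; simp
    · simp [h]
  have hrl : ∀ x i, Matrix.toLin' (Matrix.diagonal (Function.update (1 : σ → ℝ) i₀ (-1))) x i =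
      Function.update (1 : σ → ℝ) i₀ (-1) i * x i := fun x i => by
    rw [Matrix.toLin'_apply, Matrix.mulVec_diagonal]
  have hrl2 : (Matrix.toLin' (Matrix.diagonal (Function.update (1 : σ → ℝ) i₀ (-1)))).comp
      (Matrix.toLin' (Matrix.diagonal (Function.update (1 : σ → ℝ) i₀ (-1)))) = LinearMap.id :=
    LinearMap.ext fun x => funext fun i => by
      rw [LinearMap.comp_apply, LinearMap.id_apply, hrl, hrl, ← mul_assoc, hv, one_mul]
  refine ⟨LinearEquiv.ofLinear _ _ hrl2 hrl2, fun x y => ?_, LinearEquiv.ext fun x => ?_, ?_⟩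
  · show dotPairing σ (Matrix.toLin' _ x) (Matrix.toLin' _ y) = dotPairing σ x y
    rw [dotPairing_apply, dotPairing_apply, dotProduct, dotProduct]
    exact Finset.sum_congr rfl fun i _ => by
      rw [hrl, hrl]
      calc Function.update (1 : σ → ℝ) i₀ (-1) i * x i * (Function.update (1 : σ → ℝ) i₀ (-1) i * y i)
          = (Function.update (1 : σ → ℝ) i₀ (-1) i * Function.update (1 : σ → ℝ) i₀ (-1) i) * (x i * y i) := by ring
        _ = x i * y i := by rw [hv, one_mul]
  · rw [LinearEquiv.mul_apply]
    show Matrix.toLin' _ (Matrix.toLin' _ x) = x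
    exact funext fun i => by rw [hrl, hrl, ← mul_assoc, hv, one_mul]
  · show LinearMap.det (Matrix.toLin' (Matrix.diagonal (Function.update (1 : σ → ℝ) i₀ (-1)))) = -1
    rw [LinearMap.det_toLin', Matrix.det_diagonal, Finset.prod_update_of_mem (Finset.mem_univ i₀)]
    simp

omit [DecidableEq σ] in
/-- `levi 1 1 = 1`, in the form needed under a rewrite of the arguments. [cite: Folland1989, §4.2 (4.24)] -/
private theorem levi_eq_one {a d : (σ → ℝ) ≃ₗ[ℝ] (σ → ℝ)} {had : ∀ x y, dotPairing σ (a x) (d y) = dotPairing σ x y}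
    (ha : a = 1) (hd : d = 1) : levi a d had = 1 := by
  subst ha hd
  exact levi_one had

/-- **THE DOUBLE COVER DOES NOT SPLIT OVER THE FULL SIEGEL LEVI `GL(n, ℝ)`** (`σ ≠ ∅`): there is NO homomorphism
`s : {(a, ᵗa⁻¹)} →* Mp₂(W)` over `m(a, ᵗa⁻¹)` — although the `S¹`-extension `Mp^𝓢(W)` does split there by `leviHom`.
Indeed for a coordinate reflection `r` (`det r = −1`, `r² = 1`) a metaplectic lift of `m(r, r)` is `c · levi r r` with
`c² = −1`, so its square is `c² · levi 1 1 = −1 ≠ 1 = s(m(r,r)²)`: the inverse image of the Siegel Levi in `Mp₂(W)` is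
the NON-TRIVIAL `det^{1/2}`-cover of `GL(n, ℝ)`. [cite: Adams2007, §3, §5 Rem. 5.6; Kudla1994, §3; Folland1989, §4.2 (4.24), Thm. (4.37)] -/
theorem Mp₂.not_exists_section_leviPairs [Nonempty σ] :
    ¬ ∃ s : leviPairs σ →* Mp₂ σ, ∀ m, Mp₂.pr (s m) = leviSp (dotPairing σ) m.1.1 m.1.2 m.2 := by
  rintro ⟨s, hs⟩
  obtain ⟨r, had, hr2, hdet⟩ := exists_reflection (σ := σ)
  -- the Levi pair `m₀ = (r, r)` is an involution, so `s m₀` squares to `1`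
  have hm : (⟨(r, r), had⟩ : leviPairs σ) * ⟨(r, r), had⟩ = 1 := Subtype.ext (Prod.ext hr2 hr2)
  have hXX : ((s ⟨(r, r), had⟩ : Mp₂ σ) : MpS σ) * ((s ⟨(r, r), had⟩ : Mp₂ σ) : MpS σ) = 1 := by
    rw [← Subgroup.coe_mul, ← map_mul, hm, map_one, Subgroup.coe_one]
  -- `s m₀` is metaplectic and lies over `m(r, r)`, hence `s m₀ = c · levi r r` with `c² · sign(det r) = 1`
  have hXm : IsMetaplectic ((s ⟨(r, r), had⟩ : Mp₂ σ) : MpS σ) :=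
    Mp₂.isMetaplectic_coe (folland1989_Thm_4_37_ab_holds σ) (folland1989_Thm_4_37_c_holds σ) _
  have hXp : proj (levi r r had) = proj ((s ⟨(r, r), had⟩ : Mp₂ σ) : MpS σ) := by
    rw [proj_levi, ← Mp₂.pr_apply, hs]
  obtain ⟨c, hc, hcX⟩ := exists_eq_unitScalar_mul_of_proj_eq hXp
  rw [hcX] at hXm hXX
  have hc2 : c ^ 2 = -1 := by
    have h := (isMetaplectic_unitScalar_mul_levi_iff_sign c hc r r had).1 hXm
    rw [hdet, sign_neg (by norm_num : (-1 : ℝ) < 0), SignType.coe_neg_one] at h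
    push_cast at h
    linear_combination -h
  -- but `(c · levi r r)² = c² · levi (r²) (r²) = c² · 1`, whose vacuum coefficient is `c² = −1 ≠ 1 = C(1)`
  have hLL : levi r r had * levi r r had = 1 := by
    rw [← levi_mul r r r r had had]
    exact levi_eq_one hr2 hr2
  have hvac : vac (unitScalar c hc * levi r r had * (unitScalar c hc * levi r r had)) = c * c := by
    rw [mul_assoc, ← mul_assoc (levi r r had), ← unitScalar_mul_comm c hc (levi r r had), mul_assoc, hLL, mul_one,
      vac_unitScalar_mul, vac_unitScalar]
  have h1 : (1 : ℂ) = -1 := by rw [← hc2, sq, ← hvac, hXX, vac_one]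
  norm_num at h1

/-! ## 3. The doubling / twisted diagonal `T ↦ T ⊕ cTc` of `Sp(W)` in `Sp(W ⊕ W)` -/

/-- **The doubling section has metaplectic values**: for any implementer `y` of the beam splitter — indeed for any
`y ∈ Mp^𝓢(W ⊕ W)` — every `doublingSection y T = y · levi (leviA T) (leviD T) · y⁻¹` is metaplectic
(`det (leviA T) = 1 > 0`, and normalisation survives conjugation). [cite: Kudla1994, §§1–3; Folland1989, Thm. (4.37)] -/
theorem doublingSection_isMetaplectic (y : MpS (σ ⊕ σ)) (T : symplecticGroup (polar (dotPairing σ))) :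
    IsMetaplectic (doublingSection y T) :=
  isMetaplectic_doublingSection (folland1989_Thm_4_37_ab_holds (σ ⊕ σ)) (folland1989_Thm_4_37_c_holds (σ ⊕ σ)) y T

/-- **The fibre over the twisted diagonal**: for an implementer `y` of the beam splitter, the metaplectic elements over
`T ⊕ cTc` are exactly `± doublingSection y T`. [cite: Folland1989, Thm. (4.37); Kudla1994, §3] -/
theorem IsMetaplectic.eq_or_eq_negOne_mul_doublingSection {y : MpS (σ ⊕ σ)} (hy : proj y = Sp.beamSplitter σ)
    {x : MpS (σ ⊕ σ)} (hx : IsMetaplectic x) (T : symplecticGroup (polar (dotPairing σ)))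
    (hproj : proj x = spBlock (T, Sp.conjSp σ T)) :
    x = doublingSection y T ∨ x = negOne * doublingSection y T :=
  hx.eq_doublingSection_or (folland1989_Thm_4_37_ab_holds (σ ⊕ σ)) (folland1989_Thm_4_37_c_holds (σ ⊕ σ)) hy T hproj

/-- **There is a homomorphism `Sp(W) →* Mp^𝓢(W ⊕ W)` over the twisted diagonal with metaplectic values.**
[cite: Kudla1994, §§1–3; GelbartPiatetskishapiroRallis1987, Part A §1] -/
theorem exists_metaplectic_hom_twistedDiagonal :
    ∃ s : symplecticGroup (polar (dotPairing σ)) →* MpS (σ ⊕ σ),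
      ∀ T, proj (s T) = spBlock (T, Sp.conjSp σ T) ∧ IsMetaplectic (s T) :=
  exists_metaplectic_section_twistedDiagonal (folland1989_Thm_4_37_ab_holds (σ ⊕ σ))
    (folland1989_Thm_4_37_c_holds (σ ⊕ σ))

/-- **THE DOUBLE COVER `pr : Mp₂(W ⊕ W) → Sp(W ⊕ W)` SPLITS OVER THE TWISTED DIAGONAL `{T ⊕ cTc : T ∈ Sp(W)}`** —
equivalently over the diagonal `Sp(W)` of the doubled space `Sp(W ⊕ W⁻)`: for any implementer `y` of the beam splitter
there is a homomorphism `s : Sp(W) →* Mp₂(W ⊕ W)` which IS the doubling section (`s T = doublingSection y T` in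
`Mp^𝓢(W ⊕ W)`) and lies over `T ⊕ cTc`; the archimedean, Schwartz-model form of the splitting of the metaplectic cover
over the doubling diagonal. [cite: GelbartPiatetskishapiroRallis1987, Part A §1; Kudla1994, §§1–3; Paul1998, §1.2 (1.2.1)] -/
theorem Mp₂.exists_section_twistedDiagonal {y : MpS (σ ⊕ σ)} (hy : proj y = Sp.beamSplitter σ) :
    ∃ s : symplecticGroup (polar (dotPairing σ)) →* Mp₂ (σ ⊕ σ),
      ∀ T, (s T : MpS (σ ⊕ σ)) = doublingSection y T ∧ Mp₂.pr (s T) = spBlock (T, Sp.conjSp σ T) :=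
  ⟨(doublingSection y).codRestrict (Mp₂ (σ ⊕ σ)) fun T => Mp₂.mem_of_isMetaplectic (doublingSection_isMetaplectic y T),
    fun T => ⟨rfl, proj_doublingSection hy T⟩⟩

/-- **Splitting over the twisted diagonal, implementer-free form**: there is a homomorphism
`s : Sp(W) →* Mp₂(W ⊕ W)` with `pr (s T) = T ⊕ cTc` for all `T`. [cite: GelbartPiatetskishapiroRallis1987, Part A §1; Kudla1994, §§1–3] -/
theorem Mp₂.exists_section_twistedDiagonal' :
    ∃ s : symplecticGroup (polar (dotPairing σ)) →* Mp₂ (σ ⊕ σ), ∀ T, Mp₂.pr (s T) = spBlock (T, Sp.conjSp σ T) := by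
  obtain ⟨y, hy⟩ := exists_proj_eq_beamSplitter (σ := σ)
  obtain ⟨s, hs⟩ := Mp₂.exists_section_twistedDiagonal hy
  exact ⟨s, fun T => (hs T).2⟩

/-- **The two lifts over a point of the twisted diagonal**: an element of `Mp₂(W ⊕ W)` over `T ⊕ cTc` is
`± doublingSection y T`. [cite: Folland1989, Thm. (4.37), p. 161 L12–14; Kudla1994, §3] -/
theorem Mp₂.eq_or_eq_negOne_mul_of_pr_eq_twistedDiagonal {y : MpS (σ ⊕ σ)} (hy : proj y = Sp.beamSplitter σ)
    (T : symplecticGroup (polar (dotPairing σ))) (x : Mp₂ (σ ⊕ σ)) (hx : Mp₂.pr x = spBlock (T, Sp.conjSp σ T)) :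
    (x : MpS (σ ⊕ σ)) = doublingSection y T ∨ (x : MpS (σ ⊕ σ)) = negOne * doublingSection y T :=
  (Mp₂.isMetaplectic_coe (folland1989_Thm_4_37_ab_holds (σ ⊕ σ)) (folland1989_Thm_4_37_c_holds (σ ⊕ σ))
    x).eq_or_eq_negOne_mul_doublingSection hy T (by rw [← Mp₂.pr_apply, hx])

end MpS

end Literature.NumberTheory.Weil1964

end
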